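import Summits.RiemannHypothesis.RiemannHypothesis.Theorems.WeilTwoPrimeDeflE72Base
import Literature.NumberTheory.LFunctions.WeilBlockRowsFast
import HarnessLib

/-!
# Deflated two-prime certificate (weilCertDeflE72): the Bessel block claim `Hp = C H Cᵀ` (parity 0), rows 5–9, fast check

`WeilCert.checkHpRowT` (linear traversals) instead of the indexed `checkHpRow` decide.  Pure proof file.
-/

noncomputable section

namespace Summit.RiemannHypothesis.RiemannHypothesis.Theorems.EvenWinsBeyondArch

open Literature.NumberTheory.LFunctions

set_option maxHeartbeats 0 in
/-- Fast kernel check of claim row 5 of `Hp = C H Cᵀ` (parity 0; linear traversals, triangular `C`). [folklore] -/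
theorem checkHpRowT0_5_weilCertDeflE72 : weilCertDeflE72Base.checkHpRowT weilCertDeflE72HpE 0 5 = true := by
  decide +kernel

/-- Claim row 5 of `Hp = C H Cᵀ` (parity 0), from the fast check. [folklore] -/
theorem checkHpRow0_5_weilCertDeflE72 : weilCertDeflE72Base.checkHpRow weilCertDeflE72HpE 0 5 = true :=
  WeilCert.checkHpRow_of_T checkHpRowT0_5_weilCertDeflE72

set_option maxHeartbeats 0 in
/-- Fast kernel check of claim row 6 of `Hp = C H Cᵀ` (parity 0; linear traversals, triangular `C`). [folklore] -/
theorem checkHpRowT0_6_weilCertDeflE72 : weilCertDeflE72Base.checkHpRowT weilCertDeflE72HpE 0 6 = true := by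
  decide +kernel

/-- Claim row 6 of `Hp = C H Cᵀ` (parity 0), from the fast check. [folklore] -/
theorem checkHpRow0_6_weilCertDeflE72 : weilCertDeflE72Base.checkHpRow weilCertDeflE72HpE 0 6 = true :=
  WeilCert.checkHpRow_of_T checkHpRowT0_6_weilCertDeflE72

set_option maxHeartbeats 0 in
/-- Fast kernel check of claim row 7 of `Hp = C H Cᵀ` (parity 0; linear traversals, triangular `C`). [folklore] -/
theorem checkHpRowT0_7_weilCertDeflE72 : weilCertDeflE72Base.checkHpRowT weilCertDeflE72HpE 0 7 = true := by
  decide +kernel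

/-- Claim row 7 of `Hp = C H Cᵀ` (parity 0), from the fast check. [folklore] -/
theorem checkHpRow0_7_weilCertDeflE72 : weilCertDeflE72Base.checkHpRow weilCertDeflE72HpE 0 7 = true :=
  WeilCert.checkHpRow_of_T checkHpRowT0_7_weilCertDeflE72

set_option maxHeartbeats 0 in
/-- Fast kernel check of claim row 8 of `Hp = C H Cᵀ` (parity 0; linear traversals, triangular `C`). [folklore] -/
theorem checkHpRowT0_8_weilCertDeflE72 : weilCertDeflE72Base.checkHpRowT weilCertDeflE72HpE 0 8 = true := by
  decide +kernel

/-- Claim row 8 of `Hp = C H Cᵀ` (parity 0), from the fast check. [folklore] -/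
theorem checkHpRow0_8_weilCertDeflE72 : weilCertDeflE72Base.checkHpRow weilCertDeflE72HpE 0 8 = true :=
  WeilCert.checkHpRow_of_T checkHpRowT0_8_weilCertDeflE72

set_option maxHeartbeats 0 in
/-- Fast kernel check of claim row 9 of `Hp = C H Cᵀ` (parity 0; linear traversals, triangular `C`). [folklore] -/
theorem checkHpRowT0_9_weilCertDeflE72 : weilCertDeflE72Base.checkHpRowT weilCertDeflE72HpE 0 9 = true := by
  decide +kernel

/-- Claim row 9 of `Hp = C H Cᵀ` (parity 0), from the fast check. [folklore] -/
theorem checkHpRow0_9_weilCertDeflE72 : weilCertDeflE72Base.checkHpRow weilCertDeflE72HpE 0 9 = true :=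
  WeilCert.checkHpRow_of_T checkHpRowT0_9_weilCertDeflE72

end Summit.RiemannHypothesis.RiemannHypothesis.Theorems.EvenWinsBeyondArch
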